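import Summits.CriticalPhenomena.PercolationContinuityZ3.Theorems.PercNearOneGluingNoHeavyLowerTailGroupThreePointLBMaps
import Summits.CriticalPhenomena.PercolationContinuityZ3.Theorems.PercNearOneGluingNoHeavyLowerTailGroupThreePointLBCertificate
import Summits.CriticalPhenomena.PercolationContinuityZ3.Theorems.PercNearOneGluingNoHeavyLowerTailThreePointLBSwitching
import Literature.Probability.LatticeModels.SahiThirdOrderCorrelation
import Mathlib.Tactic.Ring
import Mathlib.Tactic.Linarith
import HarnessLib

/-!
# `NoHeavyLowerTail` (stmt-CriticalPhenomena-4575) — THEOREM `GRP3PTLB`: Sahi/Kahn `E₃ ≥ 0` for the three pairwise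
# separations of two vertex SETS and a vertex, on EVERY finite weighted graph, IV: pointwise lemma, expectation, theorem

Support file (prover prim-ineq-prove-3, gen 5; `--supports stmt-CriticalPhenomena-4575`).  No named facts, no sorries.

**Theorem** (`sahiE3_groupPairSep_nonneg`).  For Bernoulli bond percolation `prodBernoulli w` with arbitrary edge
weights on a finite vertex type `V`, any finite vertex sets `A, B` and any vertex `c`,
`0 ≤ E₃(D[A|B], D[A|c], D[B|c])`, Sahi's third-order functional (`Literature.Probability.LatticeModels.sahiE3`) of
the three pairwise GROUP-separation events `D[X|Y] = ⋂_{x ∈ X, y ∈ Y} {x ↮ y}`.  For `A = {a}`, `B = {b}` this is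
the tree theorem `ThreePointLB.sahiE3_pairSep_nonneg` (3PT-LB = SHK3⁺; prim-lit-2 / prim-cert-2); in general it is
NOT a corollary of it (group connection is not transitive; contracting `A`, `B` to points changes the marginals
the wrong way), and it is an instance of the open [Kahn2022, Conj. 5] / Sahi `C₃` for three decreasing events.
It makes the harness's census-validated `E3GRP` rows 1–3, `E3GRPb` row 1 and four-point class `(b)` theorems on all
graphs (they cut the proved-cone survivors CM3-B and KNB2 of the `NoHeavyLowerTail` LP programme).

**Proof** (this seat, FINDING-GRP3PTLB.md = prim-lit-2's PROOF-3PTLB.md "Variant C" carried from points to sets).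
Three copies `X, Y, Z`; the four switchings `Ψ₁ = (A→Y)`, `Ψ₂ = (B→Z)`, `Ψ₃ = (A→Y; B→Z)`, `Ψ₄′ = (c→Z; A→Y)`
of file II, each preserving `μ^{⊗3}`; potentials depending on the group-connection types of outputs `1, 2`
(`cert`); POINTWISE `S ≤ 0` (`cert_nonpos`: F1–F4 of file I rewrite the memberships into eleven atoms, transitivity
through the single vertex `c` and F4 give seven implications, `certP_nonpos` of file III is the finite check); and
`E[S] = −E₃` (`sum_wt3W_cert` + the linear relations among the events, where `P(D[A|B]) = P(Q)+P(Pa)+P(Pb)` is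
exactly the emptiness of the pattern `c~A, c~B, A≁B`; `cert_identity`).  Hence `E₃ = −E[S] ≥ 0`.
-/

noncomputable section

namespace Summit.CriticalPhenomena.PercolationContinuityZ3.Theorems

namespace GroupThreePointLB

open Finset Literature.Probability.Percolation Literature.Probability.Percolation.DecisionTree
open Literature.Probability.Percolation.Gladkov ThreePointLB
open scoped Classical

variable {V : Type*} [Fintype V] [DecidableEq V]

/-! ### The potentials and the pointwise certificate -/

section Cert

variable (A B : Finset V) (c : V)

/-- The pointwise certificate `S(x) = λ₀(x) + λ₁(Ψ₁ x) + λ₂(Ψ₂ x) + λ₃(Ψ₃ x) + λ₄′(Ψ₄′ x)` of FINDING-GRP3PTLB.md §2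
(prim-lit-2's Variant C potentials with group events), as indicators of box events; with `Q = {A≁B, A≁c, B≁c}`,
`Pa = {B~c, A≁B, A≁c}`, `Pb = {A~c, A≁B, B≁c}`, `Sc = {c≁A, c≁B}`, `SB = {B≁A, B≁c}`:
`λ₀ = [X∈Pa][Y: B≁c][Z: A~c] + [X∈Pb][Y: B~c][Z: A≁c] − [X∈Q][Y: B≁c][Z: A≁c]`,
`λ₁(o) = −[o₁∈Q][o₂: A~c]`, `λ₂(o) = −[o₁: B~c][o₂∈Q]`, `λ₃(o) = [o₁∈Pa][o₂∈Sc]`, `λ₄′(o) = [o₁∈SB][o₂∈Sc]`. [this work] -/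
def cert (x : Fin 3 → Finset (Sym2 V)) : ℝ :=
    ind (box (gconn B {c} ∩ ((gconn A B)ᶜ ∩ (gconn A {c})ᶜ)) (gconn B {c})ᶜ (gconn A {c})) x
  + ind (box (gconn A {c} ∩ ((gconn A B)ᶜ ∩ (gconn B {c})ᶜ)) (gconn B {c}) (gconn A {c})ᶜ) x
  - ind (box ((gconn A B)ᶜ ∩ ((gconn A {c})ᶜ ∩ (gconn B {c})ᶜ)) (gconn B {c})ᶜ (gconn A {c})ᶜ) x
  - ind (box Set.univ ((gconn A B)ᶜ ∩ ((gconn A {c})ᶜ ∩ (gconn B {c})ᶜ)) (gconn A {c})) (psi1 A x)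
  - ind (box Set.univ (gconn B {c}) ((gconn A B)ᶜ ∩ ((gconn A {c})ᶜ ∩ (gconn B {c})ᶜ))) (psi2 B x)
  + ind (box Set.univ (gconn B {c} ∩ ((gconn A B)ᶜ ∩ (gconn A {c})ᶜ)) ((gconn A {c})ᶜ ∩ (gconn B {c})ᶜ))
      (psi3 A B x)
  + ind (box Set.univ ((gconn A B)ᶜ ∩ (gconn B {c})ᶜ) ((gconn A {c})ᶜ ∩ (gconn B {c})ᶜ)) (psi4 {c} A x)

end Cert

omit [Fintype V] [DecidableEq V] in
/-- `ind (box E₀ E₁ E₂) y` is the `pind` of any equivalent proposition. [folklore] -/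
theorem ind_box_eq {E₀ E₁ E₂ : Set (Finset (Sym2 V))} {y : Fin 3 → Finset (Sym2 V)} {Q : Prop}
    (h : (y 0 ∈ E₀ ∧ y 1 ∈ E₁ ∧ y 2 ∈ E₂) ↔ Q) : ind (box E₀ E₁ E₂) y = pind Q := by
  rw [ind_eq_pind]
  exact congrArg pind (propext (mem_box.trans h))

/-- (F1 for groups, explored set in the second slot) In `X on touch (clS X B), ω elsewhere`: `A ~ B` iff `A ~ B`
in `X`. [this work] -/
theorem splice_touch_clS_mem_gconn_iff' {X : Finset (Sym2 V)} {B : Finset V} (ω : Finset (Sym2 V)) (A : Finset V) :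
    splice (touch (clS X B)) X ω ∈ gconn A B ↔ X ∈ gconn A B := by
  rw [mem_gconn_comm, splice_touch_clS_mem_gconn_iff, mem_gconn_comm]

omit [DecidableEq V] in
/-- Transitivity of group connection THROUGH ONE VERTEX: `A ~ c` and `B ~ c` give `A ~ B`. [this work] -/
theorem mem_gconn_of_mem_gconn_singleton {K : Finset (Sym2 V)} {A B : Finset V} {c : V}
    (hA : K ∈ gconn A {c}) (hB : K ∈ gconn B {c}) : K ∈ gconn A B := by
  obtain ⟨a, ha, hca⟩ := mem_gconn_singleton.1 hA
  obtain ⟨b, hb, hcb⟩ := mem_gconn_singleton.1 hB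
  exact ⟨a, ha, b, hb, mem_cl_trans hca (mem_cl_comm.1 hcb)⟩

/-- **Pointwise lemma** (FINDING-GRP3PTLB.md §3): for every graph, all `A, B, c` and every triple of
configurations, `S(x) ≤ 0`.  The memberships of the outputs are rewritten with F1/F2 for unions of clusters into
eleven atoms; transitivity through `c` and F4 give the seven implications; `certP_nonpos` is the finite check. [this work] -/
theorem cert_nonpos (A B : Finset V) (c : V) (x : Fin 3 → Finset (Sym2 V)) : cert A B c x ≤ 0 := by
  -- abbreviations
  have hBout : x 0 ∉ gconn A B → ∀ b ∈ B, b ∉ clS (x 0) A :=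
    fun h b hb hbA => h (mem_gconn_iff_clS.2 ⟨b, hb, hbA⟩)
  have hAout : x 0 ∉ gconn A B → ∀ a ∈ A, a ∉ clS (x 0) B :=
    fun h a ha haB => h (mem_gconn_comm.2 (mem_gconn_iff_clS.2 ⟨a, ha, haB⟩))
  -- the seven terms as `pind` of atom formulas
  have e0a : ind (box (gconn B {c} ∩ ((gconn A B)ᶜ ∩ (gconn A {c})ᶜ)) (gconn B {c})ᶜ (gconn A {c})) x =
      pind ((x 0 ∈ gconn B {c} ∧ x 0 ∉ gconn A B ∧ x 0 ∉ gconn A {c}) ∧ x 1 ∉ gconn B {c} ∧ x 2 ∈ gconn A {c}) :=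
    ind_box_eq (by simp only [Set.mem_inter_iff, Set.mem_compl_iff])
  have e0b : ind (box (gconn A {c} ∩ ((gconn A B)ᶜ ∩ (gconn B {c})ᶜ)) (gconn B {c}) (gconn A {c})ᶜ) x =
      pind ((x 0 ∈ gconn A {c} ∧ x 0 ∉ gconn A B ∧ x 0 ∉ gconn B {c}) ∧ x 1 ∈ gconn B {c} ∧ x 2 ∉ gconn A {c}) :=
    ind_box_eq (by simp only [Set.mem_inter_iff, Set.mem_compl_iff])
  have e0c : ind (box ((gconn A B)ᶜ ∩ ((gconn A {c})ᶜ ∩ (gconn B {c})ᶜ)) (gconn B {c})ᶜ (gconn A {c})ᶜ) x =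
      pind ((x 0 ∉ gconn A B ∧ x 0 ∉ gconn A {c} ∧ x 0 ∉ gconn B {c}) ∧ x 1 ∉ gconn B {c} ∧ x 2 ∉ gconn A {c}) :=
    ind_box_eq (by simp only [Set.mem_inter_iff, Set.mem_compl_iff])
  have e1 : ind (box Set.univ ((gconn A B)ᶜ ∩ ((gconn A {c})ᶜ ∩ (gconn B {c})ᶜ)) (gconn A {c})) (psi1 A x) =
      pind ((x 0 ∉ gconn A B ∧ x 0 ∉ gconn A {c} ∧ x 1 \ touch (clS (x 0) A) ∉ gconn B {c}) ∧
        x 2 ∈ gconn A {c}) := by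
    refine ind_box_eq ?_
    simp only [psi1_one, psi1_two, Set.mem_univ, true_and, Set.mem_inter_iff, Set.mem_compl_iff,
      splice_touch_clS_mem_gconn_iff]
    constructor
    · rintro ⟨⟨h1, h2, h3⟩, h4⟩
      exact ⟨⟨h1, h2, fun h => h3 ((splice_touch_clS_mem_gconn_iff_of_disjoint _ (hBout h1)).2 h)⟩, h4⟩
    · rintro ⟨⟨h1, h2, h3⟩, h4⟩
      exact ⟨⟨h1, h2, fun h => h3 ((splice_touch_clS_mem_gconn_iff_of_disjoint _ (hBout h1)).1 h)⟩, h4⟩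
  have e2 : ind (box Set.univ (gconn B {c}) ((gconn A B)ᶜ ∩ ((gconn A {c})ᶜ ∩ (gconn B {c})ᶜ))) (psi2 B x) =
      pind (x 1 ∈ gconn B {c} ∧ x 0 ∉ gconn A B ∧ x 2 \ touch (clS (x 0) B) ∉ gconn A {c} ∧
        x 0 ∉ gconn B {c}) := by
    refine ind_box_eq ?_
    simp only [psi2_one, psi2_two, Set.mem_univ, true_and, Set.mem_inter_iff, Set.mem_compl_iff,
      splice_touch_clS_mem_gconn_iff, splice_touch_clS_mem_gconn_iff']
    constructor
    · rintro ⟨h0, h1, h2, h3⟩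
      exact ⟨h0, h1, fun h => h2 ((splice_touch_clS_mem_gconn_iff_of_disjoint _ (hAout h1)).2 h), h3⟩
    · rintro ⟨h0, h1, h2, h3⟩
      exact ⟨h0, h1, fun h => h2 ((splice_touch_clS_mem_gconn_iff_of_disjoint _ (hAout h1)).1 h), h3⟩
  have e3 : ind (box Set.univ (gconn B {c} ∩ ((gconn A B)ᶜ ∩ (gconn A {c})ᶜ)) ((gconn A {c})ᶜ ∩ (gconn B {c})ᶜ))
      (psi3 A B x) =
      pind ((x 0 ∉ gconn A B ∧ x 0 ∉ gconn A {c} ∧ x 1 \ touch (clS (x 0) A) ∈ gconn B {c}) ∧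
        psi3 A B x 2 ∉ gconn A {c} ∧ psi3 A B x 2 ∉ gconn B {c}) := by
    refine ind_box_eq ?_
    simp only [psi3_one, Set.mem_univ, true_and, Set.mem_inter_iff, Set.mem_compl_iff,
      splice_touch_clS_mem_gconn_iff]
    constructor
    · rintro ⟨⟨h3, h1, h2⟩, h4⟩
      exact ⟨⟨h1, h2, (splice_touch_clS_mem_gconn_iff_of_disjoint _ (hBout h1)).1 h3⟩, h4⟩
    · rintro ⟨⟨h1, h2, h3⟩, h4⟩
      exact ⟨⟨(splice_touch_clS_mem_gconn_iff_of_disjoint _ (hBout h1)).2 h3, h1, h2⟩, h4⟩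
  have e4 : ind (box Set.univ ((gconn A B)ᶜ ∩ (gconn B {c})ᶜ) ((gconn A {c})ᶜ ∩ (gconn B {c})ᶜ)) (psi4 {c} A x) =
      pind ((psi4 {c} A x 1 ∉ gconn A B ∧ psi4 {c} A x 1 ∉ gconn B {c}) ∧
        x 0 ∉ gconn A {c} ∧ x 0 ∉ gconn B {c}) := by
    refine ind_box_eq ?_
    simp only [psi4_two, Set.mem_univ, true_and, Set.mem_inter_iff, Set.mem_compl_iff,
      splice_touch_clS_mem_gconn_iff']
  unfold cert
  rw [e0a, e0b, e0c, e1, e2, e3, e4]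
  -- the seven implications
  refine certP_nonpos (x 0 ∈ gconn A B) (x 0 ∈ gconn A {c}) (x 0 ∈ gconn B {c}) (x 1 ∈ gconn B {c})
    (x 2 ∈ gconn A {c}) (x 1 \ touch (clS (x 0) A) ∈ gconn B {c}) (x 2 \ touch (clS (x 0) B) ∈ gconn A {c})
    (psi3 A B x 2 ∈ gconn A {c}) (psi3 A B x 2 ∈ gconn B {c}) (psi4 {c} A x 1 ∈ gconn A B)
    (psi4 {c} A x 1 ∈ gconn B {c}) ?_ ?_ ?_ ?_ ?_ ?_ ?_
  · -- h1: transitivity through `c`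
    exact fun hA hB => mem_gconn_of_mem_gconn_singleton hA hB
  · exact fun h => mem_gconn_of_sdiff_mem_gconn h
  · exact fun h => mem_gconn_of_sdiff_mem_gconn h
  · -- h4: `A ~ B` in `X` and `c ≁ A`: a witness pair stays joined in `X on touch 𝒜 \ touch 𝒞, Y elsewhere`
    intro hAB hAc
    obtain ⟨a, ha, b, hb, hab⟩ := hAB
    rw [psi4_one]
    refine ⟨a, ha, b, hb, cl_subset_cl_splice_sdiff_clS (A := {c}) (B := A) ?_ (mem_clS_of_mem ha) _ hab⟩
    exact fun h => hAc (mem_gconn_comm.1 h)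
  · -- h5: `B ~ c` in `X` and `A ≁ B`: `c` stays joined to `B` in `X on touch ℬ \ touch 𝒜, Z elsewhere`
    intro hBc hAB
    obtain ⟨b, hb, hcb⟩ := mem_gconn_singleton.1 hBc
    rw [psi3_two]
    exact mem_gconn_singleton.2 ⟨b, hb, cl_subset_cl_splice_sdiff_clS hAB (mem_clS_of_mem hb) _ hcb⟩
  · -- h6: a `Z`-path from `A` to `c` avoiding `ℬ` survives in `X on touch ℬ \ touch 𝒜, Z elsewhere`
    intro h
    obtain ⟨a, ha, hca⟩ := mem_gconn_singleton.1 h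
    rw [psi3_two]
    exact mem_gconn_singleton.2 ⟨a, ha, cl_sdiff_touch_clS_subset_cl_splice Finset.sdiff_subset a hca⟩
  · -- h7: a `Y`-path from `B` to `c` avoiding `𝒜` survives in `X on touch 𝒜 \ touch 𝒞, Y elsewhere`
    intro h
    obtain ⟨b, hb, hcb⟩ := mem_gconn_singleton.1 h
    rw [psi4_one]
    exact mem_gconn_singleton.2 ⟨b, hb, cl_sdiff_touch_clS_subset_cl_splice Finset.sdiff_subset b hcb⟩

/-! ### The expectation of the certificate -/

section Expectation

variable (p : Sym2 V → ℝ) (D : Finset (Sym2 V)) (A B : Finset V) (c : V)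

/-- `E[S] = Σ_i E[λ_i]`, each `E[λ_i ∘ Ψ_i] = E[λ_i]` by measure preservation and each `E[λ_i]` a product of three
`PrW`'s. [this work] -/
theorem sum_wt3W_cert :
    ∑ x ∈ triples D, wt3W D p x * cert A B c x =
      PrW D p (gconn B {c} ∩ ((gconn A B)ᶜ ∩ (gconn A {c})ᶜ)) * PrW D p (gconn B {c})ᶜ * PrW D p (gconn A {c})
      + PrW D p (gconn A {c} ∩ ((gconn A B)ᶜ ∩ (gconn B {c})ᶜ)) * PrW D p (gconn B {c}) * PrW D p (gconn A {c})ᶜ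
      - PrW D p ((gconn A B)ᶜ ∩ ((gconn A {c})ᶜ ∩ (gconn B {c})ᶜ)) * PrW D p (gconn B {c})ᶜ *
          PrW D p (gconn A {c})ᶜ
      - PrW D p Set.univ * PrW D p ((gconn A B)ᶜ ∩ ((gconn A {c})ᶜ ∩ (gconn B {c})ᶜ)) * PrW D p (gconn A {c})
      - PrW D p Set.univ * PrW D p (gconn B {c}) * PrW D p ((gconn A B)ᶜ ∩ ((gconn A {c})ᶜ ∩ (gconn B {c})ᶜ))
      + PrW D p Set.univ * PrW D p (gconn B {c} ∩ ((gconn A B)ᶜ ∩ (gconn A {c})ᶜ)) *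
          PrW D p ((gconn A {c})ᶜ ∩ (gconn B {c})ᶜ)
      + PrW D p Set.univ * PrW D p ((gconn A B)ᶜ ∩ (gconn B {c})ᶜ) *
          PrW D p ((gconn A {c})ᶜ ∩ (gconn B {c})ᶜ) := by
  have h1 : ∀ E₀ E₁ E₂ : Set (Finset (Sym2 V)),
      ∑ x ∈ triples D, wt3W D p x * ind (box E₀ E₁ E₂) (psi1 A x) = PrW D p E₀ * PrW D p E₁ * PrW D p E₂ :=
    fun E₀ E₁ E₂ => by rw [sum_wt3W_psi1 p D A (ind (box E₀ E₁ E₂)), sum_wt3W_ind_box]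
  have h2 : ∀ E₀ E₁ E₂ : Set (Finset (Sym2 V)),
      ∑ x ∈ triples D, wt3W D p x * ind (box E₀ E₁ E₂) (psi2 B x) = PrW D p E₀ * PrW D p E₁ * PrW D p E₂ :=
    fun E₀ E₁ E₂ => by rw [sum_wt3W_psi2 p D B (ind (box E₀ E₁ E₂)), sum_wt3W_ind_box]
  have h3 : ∀ E₀ E₁ E₂ : Set (Finset (Sym2 V)),
      ∑ x ∈ triples D, wt3W D p x * ind (box E₀ E₁ E₂) (psi3 A B x) = PrW D p E₀ * PrW D p E₁ * PrW D p E₂ :=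
    fun E₀ E₁ E₂ => by rw [sum_wt3W_psi3 p D A B (ind (box E₀ E₁ E₂)), sum_wt3W_ind_box]
  have h4 : ∀ E₀ E₁ E₂ : Set (Finset (Sym2 V)),
      ∑ x ∈ triples D, wt3W D p x * ind (box E₀ E₁ E₂) (psi4 {c} A x) = PrW D p E₀ * PrW D p E₁ * PrW D p E₂ :=
    fun E₀ E₁ E₂ => by rw [sum_wt3W_psi4 p D A {c} (ind (box E₀ E₁ E₂)), sum_wt3W_ind_box]
  simp only [cert, mul_add, mul_sub, Finset.sum_add_distrib, Finset.sum_sub_distrib, sum_wt3W_ind_box,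
    h1, h2, h3, h4]

end Expectation

/-! ### The theorem at the finitary level -/

section Main

variable {p : Sym2 V → ℝ} (hp0 : ∀ i, 0 ≤ p i) (hp1 : ∀ i, p i ≤ 1) (D : Finset (Sym2 V)) (A B : Finset V) (c : V)
include hp0 hp1

/-- **GRP3PTLB at the finitary level.**  For every finite vertex type, every set `D` of coordinates with
probabilities `p ∈ [0,1]`, all vertex sets `A, B` and every vertex `c`, writing `d_{XY} = P(D[X|Y])` and
`s_A = P(D[A|B] ∩ D[A|c])` etc., `q = P(D[A|B] ∩ D[A|c] ∩ D[B|c])`: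
`0 ≤ 2q + d_{AB} d_{Ac} d_{Bc} − (d_{AB} s_c + d_{Ac} s_B + d_{Bc} s_A)` (Sahi's `E₃` of the three group separations).
Proof: `0 ≥ E[S] = −E₃` (`cert_nonpos`, `sum_wt3W_cert`, `cert_identity`). [this work] -/
theorem groupThreePointLB_PrW :
    0 ≤ 2 * PrW D p ((gconn A B)ᶜ ∩ ((gconn A {c})ᶜ ∩ (gconn B {c})ᶜ))
        + PrW D p (gconn A B)ᶜ * PrW D p (gconn A {c})ᶜ * PrW D p (gconn B {c})ᶜ
        - (PrW D p (gconn A B)ᶜ * PrW D p ((gconn A {c})ᶜ ∩ (gconn B {c})ᶜ)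
            + PrW D p (gconn A {c})ᶜ * PrW D p ((gconn A B)ᶜ ∩ (gconn B {c})ᶜ)
            + PrW D p (gconn B {c})ᶜ * PrW D p ((gconn A B)ᶜ ∩ (gconn A {c})ᶜ)) := by
  -- transitivity through `c`, at the level of events
  have tr : ∀ K : Finset (Sym2 V), K ∈ gconn A {c} → K ∈ gconn B {c} → K ∈ gconn A B :=
    fun K hA hB => mem_gconn_of_mem_gconn_singleton hA hB
  -- the linear relations among the events
  have R1 : PrW D p (gconn A {c}) = 1 - PrW D p (gconn A {c})ᶜ := by
    rw [eq_sub_iff_add_eq, ← PrW_union D p, Set.union_compl_self, PrW_univ]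
    exact Set.disjoint_left.2 fun K h1 h2 => h2 h1
  have R2 : PrW D p (gconn B {c}) = 1 - PrW D p (gconn B {c})ᶜ := by
    rw [eq_sub_iff_add_eq, ← PrW_union D p, Set.union_compl_self, PrW_univ]
    exact Set.disjoint_left.2 fun K h1 h2 => h2 h1
  have R3 : PrW D p (gconn B {c} ∩ ((gconn A B)ᶜ ∩ (gconn A {c})ᶜ)) =
      PrW D p ((gconn A B)ᶜ ∩ (gconn A {c})ᶜ) - PrW D p ((gconn A B)ᶜ ∩ ((gconn A {c})ᶜ ∩ (gconn B {c})ᶜ)) := by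
    rw [eq_sub_iff_add_eq, ← PrW_union D p]
    · refine PrW_congr_set D p fun K _ => ?_
      simp only [Set.mem_union, Set.mem_inter_iff, Set.mem_compl_iff]
      tauto
    · exact Set.disjoint_left.2 fun K h1 h2 => h2.2.2 h1.1
  have R4 : PrW D p (gconn A {c} ∩ ((gconn A B)ᶜ ∩ (gconn B {c})ᶜ)) =
      PrW D p ((gconn A B)ᶜ ∩ (gconn B {c})ᶜ) - PrW D p ((gconn A B)ᶜ ∩ ((gconn A {c})ᶜ ∩ (gconn B {c})ᶜ)) := by
    rw [eq_sub_iff_add_eq, ← PrW_union D p]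
    · refine PrW_congr_set D p fun K _ => ?_
      simp only [Set.mem_union, Set.mem_inter_iff, Set.mem_compl_iff]
      tauto
    · exact Set.disjoint_left.2 fun K h1 h2 => h2.2.1 h1.1
  -- the only use of `c` being ONE vertex: `D[A|B] = Q ⊔ Pa ⊔ Pb`
  have R5 : PrW D p (gconn A B)ᶜ = PrW D p ((gconn A B)ᶜ ∩ (gconn A {c})ᶜ)
      + PrW D p ((gconn A B)ᶜ ∩ (gconn B {c})ᶜ) - PrW D p ((gconn A B)ᶜ ∩ ((gconn A {c})ᶜ ∩ (gconn B {c})ᶜ)) := by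
    rw [add_sub_assoc, ← R4, ← PrW_union D p]
    · refine PrW_congr_set D p fun K _ => ?_
      simp only [Set.mem_union, Set.mem_inter_iff, Set.mem_compl_iff]
      have := tr K
      tauto
    · exact Set.disjoint_left.2 fun K h1 h2 => h1.2 h2.1
  have hU : PrW D p (Set.univ : Set (Finset (Sym2 V))) = 1 := PrW_univ D p
  -- E[S] ≤ 0
  have hle : ∑ x ∈ triples D, wt3W D p x * cert A B c x ≤ 0 :=
    Finset.sum_nonpos fun x _ =>
      mul_nonpos_of_nonneg_of_nonpos (DTree3.wt3W_nonneg D hp0 hp1 x) (cert_nonpos A B c x)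
  rw [sum_wt3W_cert, R1, R2, R3, R4, hU] at hle
  rw [R5]
  have hid := cert_identity (PrW D p ((gconn A B)ᶜ ∩ ((gconn A {c})ᶜ ∩ (gconn B {c})ᶜ)))
    (PrW D p ((gconn A B)ᶜ ∩ (gconn A {c})ᶜ)) (PrW D p ((gconn A B)ᶜ ∩ (gconn B {c})ᶜ))
    (PrW D p ((gconn A {c})ᶜ ∩ (gconn B {c})ᶜ)) (PrW D p (gconn B {c})ᶜ) (PrW D p (gconn A {c})ᶜ)
  linarith

end Main

end GroupThreePointLB

/-! ### The theorem for `prodBernoulli w`: Sahi's `E₃ ≥ 0` on the three pairwise group separations -/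

namespace GroupThreePointLB

section Measure

open Finset Literature.Probability.Percolation Literature.Probability.Percolation.DecisionTree
open Literature.Probability.Percolation.Gladkov
open MeasureTheory Literature.Probability.LatticeModels
open scoped Classical

variable {V : Type*} [Finite V]

/-- **THEOREM (GRP3PTLB: Sahi's `C₃` for the pairwise separations of two vertex sets and a vertex), every finite
weighted graph.**  For Bernoulli bond percolation `prodBernoulli w` with arbitrary edge weights on a finite vertex
type, all finite vertex sets `A, B` and every vertex `c`:
`0 ≤ E₃(D[A|B], D[A|c], D[B|c]) = 2μ(D_AB D_Ac D_Bc) + μ(D_AB)μ(D_Ac)μ(D_Bc) − μ(D_AB)μ(D_Ac D_Bc) − μ(D_Ac)μ(D_AB D_Bc) − μ(D_Bc)μ(D_AB D_Ac)`,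
`D[X|Y] = ⋂_{x∈X, y∈Y} {x ↮ y}` — an instance of [Kahn2022, Conjecture 5] / Sahi's `C₃` for three decreasing events,
containing `ThreePointLB.sahiE3_pairSep_nonneg` (`A, B` singletons).  Source of the proof: this seat's
FINDING-GRP3PTLB.md (prim-lit-2's PROOF-3PTLB.md Variant C for vertex sets). [this work] -/
theorem sahiE3_groupPairSep_nonneg (w : Sym2 V → unitInterval) (A B : Finset V) (c : V) :
    0 ≤ sahiE3 (prodBernoulli w) (⋂ a ∈ A, ⋂ b ∈ B, (openConn a b)ᶜ) (⋂ a ∈ A, (openConn a c)ᶜ)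
      (⋂ b ∈ B, (openConn b c)ᶜ) := by
  obtain ⟨_instV⟩ := nonempty_fintype V
  have hp0 : ∀ e, 0 ≤ (w e : ℝ) := fun e => (w e).2.1
  have hp1 : ∀ e, (w e : ℝ) ≤ 1 := fun e => (w e).2.2
  have key := groupThreePointLB_PrW (p := fun e => (w e : ℝ)) hp0 hp1 Finset.univ A B c
  have hco : ∀ (S : Finset (Sym2 V)) (u v : V),
      (↑S : Set (Sym2 V)) ∈ openConn u v ↔ (openGraph (↑S : Set (Sym2 V))).Reachable u v :=
    fun _ _ _ => Iff.rfl
  -- membership dictionaries between the measure-side events and `gconn`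
  have mAB : ∀ S : Finset (Sym2 V), (↑S : Set (Sym2 V)) ∈ (⋂ a ∈ A, ⋂ b ∈ B, (openConn a b)ᶜ) ↔
      S ∈ (gconn A B)ᶜ := fun S => by
    simp only [Set.mem_iInter, Set.mem_compl_iff, hco, mem_gconn, mem_cl, not_exists, not_and]
  have mAc : ∀ S : Finset (Sym2 V), (↑S : Set (Sym2 V)) ∈ (⋂ a ∈ A, (openConn a c)ᶜ) ↔ S ∈ (gconn A {c})ᶜ :=
    fun S => by
    simp only [Set.mem_iInter, Set.mem_compl_iff, hco, mem_gconn_singleton, mem_cl, not_exists, not_and]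
  have mBc : ∀ S : Finset (Sym2 V), (↑S : Set (Sym2 V)) ∈ (⋂ b ∈ B, (openConn b c)ᶜ) ↔ S ∈ (gconn B {c})ᶜ :=
    fun S => by
    simp only [Set.mem_iInter, Set.mem_compl_iff, hco, mem_gconn_singleton, mem_cl, not_exists, not_and]
  have e1 : (prodBernoulli w).real ((⋂ a ∈ A, ⋂ b ∈ B, (openConn a b)ᶜ) ∩ (⋂ a ∈ A, (openConn a c)ᶜ) ∩
      (⋂ b ∈ B, (openConn b c)ᶜ)) =
      PrW Finset.univ (fun e => (w e : ℝ)) ((gconn A B)ᶜ ∩ ((gconn A {c})ᶜ ∩ (gconn B {c})ᶜ)) :=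
    prodBernoulli_real_eq_PrW_univ w fun S => by
      simp only [Set.mem_inter_iff, mAB, mAc, mBc, and_assoc]
  have e2 : (prodBernoulli w).real (⋂ a ∈ A, ⋂ b ∈ B, (openConn a b)ᶜ) =
      PrW Finset.univ (fun e => (w e : ℝ)) (gconn A B)ᶜ :=
    prodBernoulli_real_eq_PrW_univ w fun S => by simp only [mAB]
  have e3 : (prodBernoulli w).real (⋂ a ∈ A, (openConn a c)ᶜ) =
      PrW Finset.univ (fun e => (w e : ℝ)) (gconn A {c})ᶜ :=
    prodBernoulli_real_eq_PrW_univ w fun S => by simp only [mAc]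
  have e4 : (prodBernoulli w).real (⋂ b ∈ B, (openConn b c)ᶜ) =
      PrW Finset.univ (fun e => (w e : ℝ)) (gconn B {c})ᶜ :=
    prodBernoulli_real_eq_PrW_univ w fun S => by simp only [mBc]
  have e5 : (prodBernoulli w).real ((⋂ a ∈ A, (openConn a c)ᶜ) ∩ (⋂ b ∈ B, (openConn b c)ᶜ)) =
      PrW Finset.univ (fun e => (w e : ℝ)) ((gconn A {c})ᶜ ∩ (gconn B {c})ᶜ) :=
    prodBernoulli_real_eq_PrW_univ w fun S => by simp only [Set.mem_inter_iff, mAc, mBc]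
  have e6 : (prodBernoulli w).real ((⋂ a ∈ A, ⋂ b ∈ B, (openConn a b)ᶜ) ∩ (⋂ b ∈ B, (openConn b c)ᶜ)) =
      PrW Finset.univ (fun e => (w e : ℝ)) ((gconn A B)ᶜ ∩ (gconn B {c})ᶜ) :=
    prodBernoulli_real_eq_PrW_univ w fun S => by simp only [Set.mem_inter_iff, mAB, mBc]
  have e7 : (prodBernoulli w).real ((⋂ a ∈ A, ⋂ b ∈ B, (openConn a b)ᶜ) ∩ (⋂ a ∈ A, (openConn a c)ᶜ)) =
      PrW Finset.univ (fun e => (w e : ℝ)) ((gconn A B)ᶜ ∩ (gconn A {c})ᶜ) :=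
    prodBernoulli_real_eq_PrW_univ w fun S => by simp only [Set.mem_inter_iff, mAB, mAc]
  rw [sahiE3_def, e1, e2, e3, e4, e5, e6, e7]
  exact key

end Measure

end GroupThreePointLB

end Summit.CriticalPhenomena.PercolationContinuityZ3.Theorems

end
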